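import Literature.Computability.AlgebraicComplexity.LaserBreakEvenCertificate
import HarnessLib

/-!
# REVIEW-RUNBOOK sanity lemma — the hypotheses of `LaserCert.cannotBeat_of_check_12_5` hold together
# (client `pub-tensor` of the ops review-runbook generator, card S `LaserCert.cannotBeat_of_check_12_5`)

Card (2)(b) («non-vacuity») of `run/shared/lean/pub/pub-tensor/REVIEW-RUNBOOK.md`: the break-even
statement `cannotBeat_of_check_12_5` — a laser certificate `C` that passes the Boolean check at the
exponent `12/5` cannot prove `ω < ρ` for any `ρ ≤ 12/5` — quantifies over certificates `C` with
`C.check 12 5 = true` and exponents `ρ ≤ 12/5`.  This file records ONE closed theorem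
`∃ C ρ, h₁ ∧ h₂` (the shape the generator's probe matches) exhibiting such a pair: the tree's
Coppersmith–Winograd `q = 3` certificate `LaserCert.cert_CW3` (whose check at `12/5` is the tree's
`LaserCert.check_CW3`, kernel `decide`) and `ρ = 12/5` itself — the class is not empty, the certified
implication is not vacuous.  (The companion module `Data/MatrixMultiplication/OmegaCensus/Runbook/
LaserCertSanity.lean` holds the reading lemma of the check, a failing exponent `5/2` and the
monotonicity of `CannotBeat` in `ρ`.)

Review evidence only (topic module, closes no item); no definitions, no `sorry`, standard axioms.
-/

namespace Summit.MatrixMultiplication.OmegaCensus.Runbook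

open Literature.Computability.AlgebraicComplexity

/-- (b) **The two hypotheses of `LaserCert.cannotBeat_of_check_12_5` hold together**: the
Coppersmith–Winograd `q = 3` certificate `cert_CW3` passes the check at the exponent `12/5`
(`LaserCert.check_CW3`) and `ρ = 12/5 ≤ 12/5`.  (At this instance the statement reads: `CW_3` with this
dual cannot prove `ω < 2.4`.) [folklore] -/
theorem cannotBeat_of_check_12_5_hypotheses :
    ∃ (C : LaserCert) (ρ : ℝ), C.check 12 5 = true ∧ ρ ≤ 12 / 5 :=
  ⟨LaserCert.cert_CW3, 12 / 5, LaserCert.check_CW3, le_rfl⟩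

end Summit.MatrixMultiplication.OmegaCensus.Runbook
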